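import Mathlib
import HarnessLib

/-!
# Stub `stub_nashL2Decay` of line `Sketch` (crux `HoelderEscapeProfile.LocalEnergyHalfHoelder`, item
stmt-AtomisticToContinuum-16008) — the ℓ² HALF OF THE DISCRETE NASH ARGUMENT

Pure real analysis (Mathlib only, no named facts).  For `S F : ℤ → ℝ → ℝ` with `Σ|S(·,t)| < ∞`,
`y(t) := Σ'ₓ S(x,t)²` and `g(t) := Σ'ₓ F(x,t)(S(x+1,t) − S(x,t))` continuous on `[t₀,∞)`, the dissipation
identity `y(t₂) − y(t₁) = 2∫_{t₁}^{t₂} g`, coercivity `l·Σ'(∇S)² ≤ −g` and the mass bound `Σ'|S| ≤ A`, one has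
`y(t) ≤ A²/√(l(t−t₀))` for every `t > t₀`.

Proof.
* `nashSeq_sq_le` (sup bound by AM–GM telescoping): for `u : ℤ → ℝ` absolutely summable, `ε > 0` and every `x`,
  `u x² ≤ 2ε·Σ'u² + Σ'(∇u)²/(2ε)` — telescope `u x² − u(x−n)² = Σ (u(y+1)² − u y²)` with
  `u(y+1)² − u y² = ∇u(y)(u(y+1) + u y) ≤ ε(u(y+1)² + u y²) + (∇u(y))²/(2ε)`, bound the partial sums of the
  summable majorant by its full sum, and let `n → ∞` (`u(x−n) → 0` by `Summable.tendsto_cofinite_zero`).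
* `nashSeq_nash` (discrete Nash): `(Σ'u²)³ ≤ 4(Σ'|u|)⁴·Σ'(∇u)²` — from the sup bound,
  `Y := Σ'u² ≤ √K_ε·Σ'|u|`, i.e. `Y² ≤ K_ε U²`, and the choice `ε = Y/(4U²)`.
* `nashODE_comparison`: if `l·y³ ≤ −4K·g` on `[t₀,∞)` then `y(t)²·l(t−t₀) ≤ K` — `y` is non-increasing, has
  derivative `2g` on `(t₀,∞)` (`intervalIntegral.integral_hasDerivAt_right`), and where `y(t) > 0` the function
  `z = 1/y²` has `z' = −4g/y³ ≥ l/K` on `(t₀,t)`, so `z(t) ≥ (l/K)(t−t₀)` (`Convex.mul_sub_le_image_sub_of_le_deriv`).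
* `stub_nashL2Decay`: Nash + `Σ'|S| ≤ A` + coercivity give `l·y³ ≤ 4A⁴·lΣ'(∇S)² ≤ −4A⁴g`; apply the comparison
  with `K = A⁴` and take square roots.

`Stmt.stub_nashL2Decay` below is a VERBATIM copy of the statement abbreviation of the skeleton
`Cruxes/LocalEnergyHalfHoelder/Lines/Sketch.lean` (namespace `…Theorems.LocalEnergyHalfHoelder.NashDoubling` here, so
the skeleton can import this file without name clashes); `stub_nashL2Decay` proves it and
`stub_nashL2Decay_explicit` restates it unfolded.
-/

noncomputable section

open MeasureTheory Set Filter Topology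

namespace Summit.AtomisticToContinuum.FouriersLaw.Theorems.LocalEnergyHalfHoelder.NashDoubling

/-! ### The discrete Nash inequality on `ℤ` -/

/-- An absolutely summable real sequence is square summable (`u x² ≤ (Σ'|u|)·|u x|`). -/
theorem nashSeq_summable_sq (u : ℤ → ℝ) (hu : Summable fun x => |u x|) :
    Summable fun x => u x ^ 2 := by
  refine (hu.mul_left (∑' y, |u y|)).of_nonneg_of_le (fun x => sq_nonneg _) (fun x => ?_)
  have hx : |u x| ≤ ∑' y, |u y| := hu.le_tsum x (fun y _ => abs_nonneg _)
  calc u x ^ 2 = |u x| * |u x| := by rw [← sq_abs, sq]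
    _ ≤ (∑' y, |u y|) * |u x| := mul_le_mul_of_nonneg_right hx (abs_nonneg _)

/-- Square summability of the shifted sequence `x ↦ u (x+1)`. -/
theorem nashSeq_summable_sq_shift (u : ℤ → ℝ) (hu : Summable fun x => |u x|) :
    Summable fun x => u (x + 1) ^ 2 :=
  (nashSeq_summable_sq u hu).comp_injective (add_left_injective 1)

/-- Square summability of the discrete gradient: `(u(x+1) − u x)² ≤ 2(u(x+1)² + u x²)`. -/
theorem nashSeq_summable_grad (u : ℤ → ℝ) (hu : Summable fun x => |u x|) :
    Summable fun x => (u (x + 1) - u x) ^ 2 := by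
  refine (((nashSeq_summable_sq_shift u hu).add (nashSeq_summable_sq u hu)).mul_left 2).of_nonneg_of_le
    (fun x => sq_nonneg _) (fun x => ?_)
  nlinarith [sq_nonneg (u (x + 1) + u x)]

/-- **Sup bound by AM–GM telescoping.** For absolutely summable `u : ℤ → ℝ`, every `ε > 0` and every site
`x`: `u x² ≤ 2ε·Σ'u² + Σ'(u(y+1) − u y)²/(2ε)`.  Telescoping `u x² − u(x−n)² = Σ_{x−n ≤ y < x}(u(y+1)² − u y²)`
with `u(y+1)² − u y² = (u(y+1) − u y)(u(y+1) + u y) ≤ ε(u(y+1)² + u y²) + (u(y+1) − u y)²/(2ε)`; the partial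
sums of this nonnegative summable majorant are at most its full sum `2εΣ'u² + Σ'(∇u)²/(2ε)`, and
`u(x−n) → 0` as `n → ∞`. -/
theorem nashSeq_sq_le (u : ℤ → ℝ) (hu : Summable fun x => |u x|) {ε : ℝ} (hε : 0 < ε) (x : ℤ) :
    u x ^ 2 ≤ 2 * ε * ∑' y, u y ^ 2 + (∑' y, (u (y + 1) - u y) ^ 2) / (2 * ε) := by
  have hY := nashSeq_summable_sq u hu
  have hY1 := nashSeq_summable_sq_shift u hu
  have hG := nashSeq_summable_grad u hu
  -- the summable majorant of the telescoping increments
  obtain ⟨v, hv⟩ : ∃ v : ℤ → ℝ,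
      ∀ y, v y = ε * (u (y + 1) ^ 2 + u y ^ 2) + (u (y + 1) - u y) ^ 2 / (2 * ε) :=
    ⟨fun y => ε * (u (y + 1) ^ 2 + u y ^ 2) + (u (y + 1) - u y) ^ 2 / (2 * ε), fun y => rfl⟩
  have hv_summ : Summable v := by
    rw [show v = fun y => ε * (u (y + 1) ^ 2 + u y ^ 2) + (u (y + 1) - u y) ^ 2 / (2 * ε) from funext hv]
    exact ((hY1.add hY).mul_left ε).add (hG.div_const (2 * ε))
  have hv_nonneg : ∀ y, 0 ≤ v y := fun y => by rw [hv y]; positivity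
  have hv_tsum : ∑' y, v y = 2 * ε * ∑' y, u y ^ 2 + (∑' y, (u (y + 1) - u y) ^ 2) / (2 * ε) := by
    have hshift : ∑' y, u (y + 1) ^ 2 = ∑' y, u y ^ 2 := by
      simpa using (Equiv.addRight (1 : ℤ)).tsum_eq (fun y => u y ^ 2)
    have hA : ∑' y, v y =
        ∑' y, ε * (u (y + 1) ^ 2 + u y ^ 2) + ∑' y, (u (y + 1) - u y) ^ 2 / (2 * ε) := by
      rw [tsum_congr hv]
      exact ((hY1.add hY).mul_left ε).tsum_add (hG.div_const (2 * ε))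
    have hB : ∑' y, ε * (u (y + 1) ^ 2 + u y ^ 2) = ε * (∑' y, u (y + 1) ^ 2 + ∑' y, u y ^ 2) := by
      rw [tsum_mul_left, hY1.tsum_add hY]
    have hC : ∑' y, (u (y + 1) - u y) ^ 2 / (2 * ε) = (∑' y, (u (y + 1) - u y) ^ 2) / (2 * ε) :=
      tsum_div_const
    rw [hA, hB, hC, hshift]
    ring
  -- one increment is dominated by the majorant
  have hstep : ∀ y, u (y + 1) ^ 2 - u y ^ 2 ≤ v y := by
    intro y
    have h1 : (u (y + 1) - u y) * (u (y + 1) + u y) ≤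
        ε * (u (y + 1) + u y) ^ 2 / 2 + (u (y + 1) - u y) ^ 2 / (2 * ε) := by
      rw [div_add_div _ _ two_ne_zero (by positivity), le_div_iff₀ (by positivity)]
      nlinarith [sq_nonneg ((u (y + 1) - u y) - ε * (u (y + 1) + u y))]
    have h2 : ε * (u (y + 1) + u y) ^ 2 / 2 ≤ ε * (u (y + 1) ^ 2 + u y ^ 2) := by
      nlinarith [mul_nonneg hε.le (sq_nonneg (u (y + 1) - u y))]
    rw [hv y]
    nlinarith [h1, h2]
  -- telescoping from `x - n` up to `x`
  have htel : ∀ n : ℕ, u x ^ 2 ≤ u (x - n) ^ 2 + ∑ i ∈ Finset.range n, v (x - 1 - i) := by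
    intro n
    induction n with
    | zero => simp
    | succ n ih =>
      have hs := hstep (x - 1 - n)
      have e1 : x - 1 - (n : ℤ) + 1 = x - n := by ring
      have e2 : x - ((n : ℤ) + 1) = x - 1 - n := by ring
      rw [e1] at hs
      rw [Finset.sum_range_succ, Nat.cast_succ, e2]
      linarith
  -- the partial sums of the majorant are bounded by its full sum
  have hpart : ∀ n : ℕ, ∑ i ∈ Finset.range n, v (x - 1 - i) ≤ ∑' y, v y := by
    intro n
    have hinj : Set.InjOn (fun i : ℕ => x - 1 - (i : ℤ)) (Finset.range n) := by
      intro i _ j _ h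
      simp only at h
      omega
    calc ∑ i ∈ Finset.range n, v (x - 1 - i)
        = ∑ y ∈ (Finset.range n).image (fun i : ℕ => x - 1 - (i : ℤ)), v y :=
          (Finset.sum_image hinj).symm
      _ ≤ ∑' y, v y := hv_summ.sum_le_tsum _ (fun y _ => hv_nonneg y)
  -- pass to the limit `n → ∞`, where `u (x - n) → 0`
  have hlim : Tendsto (fun n : ℕ => u (x - n) ^ 2) atTop (𝓝 0) := by
    have hinj : Function.Injective (fun n : ℕ => x - (n : ℤ)) := by
      intro i j h
      simp only at h
      omega
    have h1 := hinj.tendsto_cofinite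
    rw [Nat.cofinite_eq_atTop] at h1
    exact hY.tendsto_cofinite_zero.comp h1
  have hbound : ∀ n : ℕ, u x ^ 2 - ∑' y, v y ≤ u (x - n) ^ 2 := fun n => by
    linarith [htel n, hpart n]
  have := ge_of_tendsto' hlim hbound
  linarith [hv_tsum]

/-- **Discrete Nash inequality on `ℤ`.**  For absolutely summable `u`:
`(Σ' u²)³ ≤ 4·(Σ'|u|)⁴·Σ'(u(x+1) − u x)²`.  From the sup bound `u x² ≤ K_ε := 2εY + G/(2ε)`
(`Y = Σ'u²`, `G = Σ'(∇u)²`, `U = Σ'|u|`): `Y = Σ'|u|·|u| ≤ √K_ε·U`, so `Y² ≤ K_ε U²` for every `ε > 0`,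
and the choice `ε = Y/(4U²)` gives `Y³ ≤ 4U⁴G`. -/
theorem nashSeq_nash (u : ℤ → ℝ) (hu : Summable fun x => |u x|) :
    (∑' x, u x ^ 2) ^ 3 ≤ 4 * (∑' x, |u x|) ^ 4 * ∑' x, (u (x + 1) - u x) ^ 2 := by
  have hY := nashSeq_summable_sq u hu
  have hsup := fun (ε : ℝ) (hε : 0 < ε) => nashSeq_sq_le u hu hε
  set Y := ∑' x, u x ^ 2 with hYdef
  set G := ∑' x, (u (x + 1) - u x) ^ 2 with hGdef
  set U := ∑' x, |u x| with hUdef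
  have hY0 : 0 ≤ Y := tsum_nonneg fun x => sq_nonneg _
  have hG0 : 0 ≤ G := tsum_nonneg fun x => sq_nonneg _
  have hU0 : 0 ≤ U := tsum_nonneg fun x => abs_nonneg _
  -- `Y² ≤ K_ε U²` for every `ε > 0`
  have hstar : ∀ ε : ℝ, 0 < ε → Y ^ 2 ≤ (2 * ε * Y + G / (2 * ε)) * U ^ 2 := by
    intro ε hε
    have hK0 : 0 ≤ 2 * ε * Y + G / (2 * ε) := by positivity
    have hux : ∀ x, |u x| ≤ Real.sqrt (2 * ε * Y + G / (2 * ε)) := fun x =>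
      Real.abs_le_sqrt (hsup ε hε x)
    have h1 : Y ≤ Real.sqrt (2 * ε * Y + G / (2 * ε)) * U := by
      rw [hUdef, ← tsum_mul_left]
      refine hY.tsum_le_tsum (fun x => ?_) (hu.mul_left _)
      calc u x ^ 2 = |u x| * |u x| := by rw [← sq_abs, sq]
        _ ≤ Real.sqrt (2 * ε * Y + G / (2 * ε)) * |u x| :=
          mul_le_mul_of_nonneg_right (hux x) (abs_nonneg _)
    calc Y ^ 2 ≤ (Real.sqrt (2 * ε * Y + G / (2 * ε)) * U) ^ 2 := pow_le_pow_left₀ hY0 h1 2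
      _ = (2 * ε * Y + G / (2 * ε)) * U ^ 2 := by rw [mul_pow, Real.sq_sqrt hK0]
  rcases hY0.eq_or_lt with hY00 | hYpos
  · rw [← hY00, zero_pow three_ne_zero]
    exact mul_nonneg (by positivity) hG0
  · have hUpos : 0 < U := by
      rcases hU0.eq_or_lt with hU00 | hUpos
      · have := hstar 1 one_pos
        rw [← hU00] at this
        nlinarith
      · exact hUpos
    have hYne : Y ≠ 0 := hYpos.ne'
    have hUne : U ≠ 0 := hUpos.ne'
    have h := hstar (Y / (4 * U ^ 2)) (by positivity)
    have e : (2 * (Y / (4 * U ^ 2)) * Y + G / (2 * (Y / (4 * U ^ 2)))) * U ^ 2 =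
        Y ^ 2 / 2 + 2 * G * U ^ 4 / Y := by
      field_simp
      ring
    rw [e] at h
    have h' : Y ^ 2 / 2 ≤ 2 * G * U ^ 4 / Y := by linarith
    rw [div_le_div_iff₀ two_pos hYpos] at h'
    nlinarith [h']

/-! ### The ODE comparison -/

/-- **ODE comparison, derivative form.**  If `y ≥ 0` is continuous on `[t₀,∞)` with
`y t₂ − y t₁ = 2∫_{t₁}^{t₂} g` (`g` continuous on `[t₀,∞)`) and `l·y³ ≤ −4K·g` on `[t₀,∞)` (`l > 0`, `K ≥ 0`),
then `y(t)²·l(t−t₀) ≤ K` for `t > t₀`.  Indeed `g ≤ 0`, so `y` is non-increasing; if `y(t) > 0` then `y > 0` on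
`[t₀,t]`, `y' = 2g` on `(t₀,∞)` (FTC, `intervalIntegral.integral_hasDerivAt_right`), and `z = 1/y²` satisfies
`z' = −4g/y³ ≥ l/K`, whence `(l/K)(t−t₀) ≤ z(t) − z(t₀) ≤ z(t)` (`Convex.mul_sub_le_image_sub_of_le_deriv`). -/
theorem nashODE_comparison (y g : ℝ → ℝ) (l K t₀ t : ℝ) (hl : 0 < l) (hK : 0 ≤ K) (ht : t₀ < t)
    (hyc : ContinuousOn y (Set.Ici t₀)) (hgc : ContinuousOn g (Set.Ici t₀))
    (hftc : ∀ t₁ t₂ : ℝ, t₀ ≤ t₁ → t₁ ≤ t₂ → y t₂ - y t₁ = 2 * ∫ s in t₁..t₂, g s)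
    (hy0 : ∀ s, t₀ ≤ s → 0 ≤ y s) (hdis : ∀ s, t₀ ≤ s → l * y s ^ 3 ≤ -(4 * K * g s)) :
    y t ^ 2 * (l * (t - t₀)) ≤ K := by
  rcases (hy0 t ht.le).eq_or_lt with hyt | hyt
  · rw [← hyt]
    simpa using hK
  -- `K > 0`
  have hKpos : 0 < K := by
    rcases hK.eq_or_lt with hK0 | hKpos
    · have h1 := hdis t ht.le
      rw [← hK0] at h1
      have h2 : 0 < l * y t ^ 3 := by positivity
      linarith
    · exact hKpos
  -- `g ≤ 0` on `[t₀, ∞)`, so `y` is non-increasing there and positive on `[t₀, t]`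
  have hg0 : ∀ s, t₀ ≤ s → g s ≤ 0 := by
    intro s hs
    have h1 := hdis s hs
    have h2 : 0 ≤ l * y s ^ 3 := mul_nonneg hl.le (pow_nonneg (hy0 s hs) 3)
    nlinarith
  have hanti : ∀ a b, t₀ ≤ a → a ≤ b → y b ≤ y a := by
    intro a b ha hab
    have h1 := hftc a b ha hab
    have h2 : 0 ≤ ∫ s in a..b, -g s :=
      intervalIntegral.integral_nonneg hab (fun s hs => neg_nonneg.2 (hg0 s (ha.trans hs.1)))
    rw [intervalIntegral.integral_neg] at h2
    linarith
  have hypos : ∀ s, t₀ ≤ s → s ≤ t → 0 < y s := fun s hs hst => hyt.trans_le (hanti s t hs hst)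
  -- `y' = 2g` on `(t₀, ∞)`
  have hderiv : ∀ s, t₀ < s → HasDerivAt y (2 * g s) s := by
    intro s hs
    have hint : IntervalIntegrable g volume t₀ s := by
      refine (hgc.mono ?_).intervalIntegrable
      rw [Set.uIcc_of_le hs.le]
      exact Set.Icc_subset_Ici_self
    have hmeas : StronglyMeasurableAtFilter g (𝓝 s) volume :=
      (hgc.mono Set.Ioi_subset_Ici_self).stronglyMeasurableAtFilter isOpen_Ioi s hs
    have hcont : ContinuousAt g s := hgc.continuousAt (Ici_mem_nhds hs)
    have h1 : HasDerivAt (fun u => ∫ τ in t₀..u, g τ) (g s) s :=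
      intervalIntegral.integral_hasDerivAt_right hint hmeas hcont
    have h2 : HasDerivAt (fun u => y t₀ + 2 * ∫ τ in t₀..u, g τ) (2 * g s) s :=
      (h1.const_mul 2).const_add (y t₀)
    refine h2.congr_of_eventuallyEq ?_
    filter_upwards [Ioi_mem_nhds hs] with u hu
    have h3 := hftc t₀ u le_rfl (le_of_lt hu)
    linarith
  -- `z = 1/y²` on `[t₀, t]`: continuity, differentiability and `z' ≥ l/K` in the interior
  have hzc : ContinuousOn (fun u => (y u ^ 2)⁻¹) (Set.Icc t₀ t) :=
    ((hyc.mono Set.Icc_subset_Ici_self).pow 2).inv₀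
      (fun s hs => (pow_pos (hypos s hs.1 hs.2) 2).ne')
  have hzd : DifferentiableOn ℝ (fun u => (y u ^ 2)⁻¹) (interior (Set.Icc t₀ t)) := by
    rw [interior_Icc]
    intro s hs
    exact (((hderiv s hs.1).fun_pow 2).fun_inv
      (pow_pos (hypos s hs.1.le hs.2.le) 2).ne').differentiableAt.differentiableWithinAt
  have hzge : ∀ s ∈ interior (Set.Icc t₀ t), l / K ≤ deriv (fun u => (y u ^ 2)⁻¹) s := by
    intro s hs
    rw [interior_Icc] at hs
    have hys := hypos s hs.1.le hs.2.le
    have hz := ((hderiv s hs.1).fun_pow 2).fun_inv (pow_pos hys 2).ne'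
    rw [hz.deriv, div_le_div_iff₀ hKpos (by positivity)]
    have h1 : y s * (l * y s ^ 3) ≤ y s * (-(4 * K * g s)) :=
      mul_le_mul_of_nonneg_left (hdis s hs.1.le) hys.le
    norm_num
    nlinarith [h1]
  have hmv := (convex_Icc t₀ t).mul_sub_le_image_sub_of_le_deriv hzc hzd hzge t₀
    (Set.left_mem_Icc.2 ht.le) t (Set.right_mem_Icc.2 ht.le) ht.le
  -- conclude: `(l/K)(t - t₀) ≤ 1/y(t)² - 1/y(t₀)² ≤ 1/y(t)²`
  have hz0 : 0 ≤ (y t₀ ^ 2)⁻¹ := by positivity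
  have hmain : l / K * (t - t₀) ≤ (y t ^ 2)⁻¹ := by linarith
  rw [div_mul_eq_mul_div, div_le_iff₀ hKpos] at hmain
  have hyt2 : 0 < y t ^ 2 := by positivity
  calc y t ^ 2 * (l * (t - t₀)) ≤ y t ^ 2 * ((y t ^ 2)⁻¹ * K) :=
        mul_le_mul_of_nonneg_left hmain hyt2.le
    _ = K := by field_simp

/-! ### The registered stub -/

/-- **stub `stub_nashL2Decay` (PURE REAL ANALYSIS, provable now; size M) — the ℓ² half of the discrete Nash argument (first half of the planner's proved `NashLowerEnvelope`, stmt-15158, whose exported statement does not expose it).** For any `S F : ℤ → ℝ → ℝ`: summability of `|S(·,t)|`, continuity of `ΣS²` and `ΣF∇S` on `[t₀,∞)`, the dissipation identity, coercivity `l·Σ(∇S)² ≤ −ΣF∇S` and `Σ|S| ≤ A` give `ΣₓS(x,t)² ≤ A²/√(l(t−t₀))` for `t > t₀` (discrete Nash `(Σu²)³ ≤ 4(Σ|u|)⁴Σ(∇u)²` from `‖u‖_∞² ≤ 2‖u‖₂‖∇u‖₂`, `‖u‖₂² ≤ ‖u‖_∞‖u‖₁`; then `y = ΣS²` is non-increasing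 with `y' ≤ −(l/2A⁴)y³`, so `1/y²` grows at rate `≥ l/A⁴`). Reusable verbatim by line `birth` of crux LinearSpread. -/
abbrev Stmt.stub_nashL2Decay : Prop :=
    ∀ (S F : ℤ → ℝ → ℝ) (l A t₀ : ℝ), 0 < l → (∀ t : ℝ, t₀ ≤ t → Summable (fun x : ℤ => |S x t|)) → ContinuousOn (fun t : ℝ => ∑' x : ℤ, (S x t) ^ 2) (Set.Ici t₀) → ContinuousOn (fun t : ℝ => ∑' x : ℤ, F x t * (S (x + 1) t - S x t)) (Set.Ici t₀) → (∀ t₁ t₂ : ℝ, t₀ ≤ t₁ → t₁ ≤ t₂ → (∑' x : ℤ, (S x t₂) ^ 2) - (∑' x : ℤ, (S x t₁) ^ 2) = 2 * ∫ s in t₁..t₂, ∑' x : ℤ, F x s * (S (x + 1) s - S x s)) → (∀ t : ℝ, t₀ ≤ t → l * ∑' x : ℤ, (S (x + 1) t - S x t) ^ 2 ≤ -∑' x : ℤ, F x t * (S (x + 1) t - S x t)) → (∀ t : ℝ, t₀ ≤ t → ∑' x : ℤ, |S x t| ≤ A) → ∀ t : ℝ, t₀ < t → Summable (fun x : ℤ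 => (S x t) ^ 2) ∧ ∑' x : ℤ, (S x t) ^ 2 ≤ A ^ 2 / Real.sqrt (l * (t - t₀))

/-- **Stub `stub_nashL2Decay` (ℓ² NASH DECAY, registered stub of line `Sketch` of crux
`HoelderEscapeProfile.LocalEnergyHalfHoelder`).**  Under the hypotheses of `Stmt.stub_nashL2Decay`, for every
`t > t₀` the sequence `S(·,t)` is square summable and `ΣₓS(x,t)² ≤ A²/√(l(t−t₀))`.  Proof: at each time
`s ≥ t₀` the discrete Nash inequality `nashSeq_nash` and `Σ'|S| ≤ A` give `y³ ≤ 4A⁴Σ'(∇S)²`, so coercivity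
yields `l·y³ ≤ −4A⁴·g`; `nashODE_comparison` with `K = A⁴` gives `y(t)²·l(t−t₀) ≤ A⁴`, and square roots
finish. -/
theorem stub_nashL2Decay : Stmt.stub_nashL2Decay := by
  intro S F l A t₀ hl habs hyc hgc hftc hcoer hA t ht
  have hsum : ∀ s : ℝ, t₀ ≤ s → Summable (fun x : ℤ => S x s ^ 2) :=
    fun s hs => nashSeq_summable_sq (fun x => S x s) (habs s hs)
  refine ⟨hsum t ht.le, ?_⟩
  have hA0 : 0 ≤ A := le_trans (tsum_nonneg fun x => abs_nonneg _) (hA t ht.le)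
  -- the differential inequality `l y³ ≤ -4A⁴ g` on `[t₀, ∞)`
  have hdis : ∀ s : ℝ, t₀ ≤ s →
      l * (∑' x : ℤ, S x s ^ 2) ^ 3 ≤ -(4 * A ^ 4 * ∑' x : ℤ, F x s * (S (x + 1) s - S x s)) := by
    intro s hs
    have hN := nashSeq_nash (fun x => S x s) (habs s hs)
    have hU0 : 0 ≤ ∑' x : ℤ, |S x s| := tsum_nonneg fun x => abs_nonneg _
    have hU : (∑' x : ℤ, |S x s|) ^ 4 ≤ A ^ 4 := pow_le_pow_left₀ hU0 (hA s hs) 4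
    have hG0 : 0 ≤ ∑' x : ℤ, (S (x + 1) s - S x s) ^ 2 := tsum_nonneg fun x => sq_nonneg _
    have h1 := mul_le_mul_of_nonneg_left hN hl.le
    have h2 := mul_le_mul_of_nonneg_left (mul_le_mul_of_nonneg_right hU hG0)
      (by positivity : (0 : ℝ) ≤ 4 * l)
    have h3 := mul_le_mul_of_nonneg_left (hcoer s hs) (by positivity : (0 : ℝ) ≤ 4 * A ^ 4)
    linarith
  have hy0 : ∀ s : ℝ, t₀ ≤ s → 0 ≤ ∑' x : ℤ, S x s ^ 2 := fun s _ => tsum_nonneg fun x => sq_nonneg _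
  have hode := nashODE_comparison (fun s => ∑' x : ℤ, S x s ^ 2)
    (fun s => ∑' x : ℤ, F x s * (S (x + 1) s - S x s)) l (A ^ 4) t₀ t hl (by positivity) ht
    hyc hgc hftc hy0 hdis
  -- square roots
  have hτ : 0 < l * (t - t₀) := mul_pos hl (sub_pos.2 ht)
  have hyt : 0 ≤ ∑' x : ℤ, S x t ^ 2 := hy0 t ht.le
  rw [le_div_iff₀ (Real.sqrt_pos.2 hτ)]
  have hsq : ((∑' x : ℤ, S x t ^ 2) * Real.sqrt (l * (t - t₀))) ^ 2 ≤ (A ^ 2) ^ 2 := by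
    rw [mul_pow, Real.sq_sqrt hτ.le, ← pow_mul]
    simpa using hode
  exact (sq_le_sq₀ (by positivity) (by positivity)).1 hsq

/-- **ℓ² Nash decay, unfolded form** (the statement of `Stmt.stub_nashL2Decay` written out; definitionally the
same as `stub_nashL2Decay`). -/
theorem stub_nashL2Decay_explicit : ∀ (S F : ℤ → ℝ → ℝ) (l A t₀ : ℝ), 0 < l → (∀ t : ℝ, t₀ ≤ t → Summable (fun x : ℤ => |S x t|)) → ContinuousOn (fun t : ℝ => ∑' x : ℤ, (S x t) ^ 2) (Set.Ici t₀) → ContinuousOn (fun t : ℝ => ∑' x : ℤ, F x t * (S (x + 1) t - S x t)) (Set.Ici t₀) → (∀ t₁ t₂ : ℝ, t₀ ≤ t₁ → t₁ ≤ t₂ → (∑' x : ℤ, (S x t₂) ^ 2) - (∑' x : ℤ, (S x t₁) ^ 2) = 2 * ∫ s in t₁..t₂, ∑' x : ℤ, F x s * (S (x + 1) s - S x s)) → (∀ t : ℝ, t₀ ≤ t → l * ∑' x : ℤ, (S (x + 1) t - S x t) ^ 2 ≤ -∑' x : ℤ, F x t * (S (x + 1) t - S x t)) → (∀ t : ℝ,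 t₀ ≤ t → ∑' x : ℤ, |S x t| ≤ A) → ∀ t : ℝ, t₀ < t → Summable (fun x : ℤ => (S x t) ^ 2) ∧ ∑' x : ℤ, (S x t) ^ 2 ≤ A ^ 2 / Real.sqrt (l * (t - t₀)) :=
  stub_nashL2Decay

end Summit.AtomisticToContinuum.FouriersLaw.Theorems.LocalEnergyHalfHoelder.NashDoubling

end
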